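import Mathlib.RingTheory.RootsOfUnity.Complex
import Mathlib.Algebra.Field.GeomSum
import Mathlib.Algebra.BigOperators.Field
import Mathlib.LinearAlgebra.Matrix.Kronecker
import Mathlib.Data.Matrix.Basic
import Mathlib.Algebra.BigOperators.Ring.Finset
import Mathlib.GroupTheory.Perm.Sign
import Mathlib.Logic.Equiv.Fin.Rotate
import HarnessLib

/-!
# Cyclic eigen-idempotents and slot tensor powers of matrices

The linear algebra behind Atiyah's construction of the Adams operations by *power operations*
(M. F. Atiyah, "Power operations in `K`-theory", Quart. J. Math. Oxford (2) 17 (1966) 165–193,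
§2; reprinted in Atiyah, *K-Theory*, Benjamin 1967): for a vector bundle (here: an idempotent
matrix `p` over a commutative `ℂ`-algebra `R`) the cyclic group `ℤ/k` permutes the factors of
`p^{⊗k}`, and for `k` prime `ψ^k[p] = [V_0] - [V_1]` where `V_j` is the `e^{2πij/k}`-eigenbundle
of the cyclic permutation `T` (Atiyah's formula (2.7)). This file provides, with complete proofs:

* §1 `zeta k = e^{2πi/k}` and the **character sums** `∑_{i<k} ζ^{il} = k·[k ∣ l]`
  (`sum_zeta_zpow`), the coefficients `ecoef k i j = ζ^{-ij}/k`;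
* §2 the **eigen-idempotents** `eig k T j = (1/k) ∑_{i<k} ζ^{-ij} T^i` of any element `T` of a
  `ℂ`-algebra with `T^k = 1`: `T E_j = ζ^j E_j` (`mul_eig`), the eigen-lemma
  `eig_mul_of_mul_eq_smul` (`T X = ζ^c X ⟹ E_j X = [j ≡ c] X`), orthogonality and idempotency
  (`eig_mul_eig`, `isIdempotentElem_eig`), completeness `∑_j E_j = 1` (`sum_eig`), conjugation
  (`conj_eig`), scaling `E_j(ζ^a T) = E_{j-a}(T)` (`eig_smul`), periodicity, and
  `E_j(T^{k-1}) = E_{-j}(T)` (`eig_pow_pred`);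
* §3 **slot tensor powers** `tpowF a = ⊗_m a_m`, `tpow N a = a^{⊗N}` of rectangular matrices,
  indexed by slot functions `Fin N → ι` (entry `∏_m a_m (i m) (j m)`): multiplicativity
  (`tpowF_mul`), `tpow_one`, idempotency, functoriality under ring homomorphisms; slot
  permutations `slotEquiv`, their **permutation matrices** `pm R ι σ` (a monoid homomorphism:
  `pm_mul_pm`, `pm_one`, `pm_pow`) and `P_σ (⊗ a_m) P_σ⁻¹ = ⊗ a_{σ⁻¹ m}`
  (`pm_mul_tpowF_mul_pm`), in particular `P_σ a^{⊗N} = a^{⊗N} P_σ` for rectangular `a`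
  (`pm_mul_tpow`);
* **line elements** `IsLine a` (all `2 × 2` minors vanish): slot permutations act trivially on
  `a^{⊗N}` (`IsLine.pm_mul_tpow`); `1 × 1` matrices and column-times-row products are line
  elements.

Everything is proved; there are no named facts. The Adams operations themselves are built in
`Literature/RingTheory/KTheory/AdamsOperations.lean`.

## References

* M. F. Atiyah, Power operations in `K`-theory, Quart. J. Math. Oxford (2) 17 (1966) 165–193,
  §2 (operations from the symmetric group; Prop. 2.2, 2.3, 2.5, formula (2.7)); reprinted in
  M. F. Atiyah, *K-Theory*, Benjamin (1967). [Atiyah1966PowerOperations]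

## Design notes

* The eigen-idempotents are developed for an arbitrary element `T` with `T ^ k = 1` of a ring
  `A` with `[Algebra ℂ A]`; the scalars live in `ℂ`, so the character sums are computed in a
  field (`IsPrimitiveRoot`, `geom_sum_eq`) and no domain hypothesis on `A` is needed.
* Tensor powers are indexed by `Fin N → ι` rather than iterated products, so that all slot
  permutations (cyclic shifts, reflections, flips of double structures) are plain
  re-indexings (`Equiv.prod_comp`, `Finset.prod_univ_sum`).
* Mathlib searches: `Matrix.kronecker` (binary only), `PiTensorProduct` (modules, not matrices),
  `Equiv.Perm.sign/cycleType`, `IsPrimitiveRoot`, `finRotate` — no tensor powers of matrices or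
  permutation matrices on function types; nothing restated.
-/

noncomputable section

namespace Literature.RingTheory.KTheory





open Finset

/-! ### 1. Character sums of `k`-th roots of unity -/

section CharSum

/-- The standard primitive `k`-th root of unity `ζ_k = e^{2πi/k}`. [folklore] -/
def zeta (k : ℕ) : ℂ := Complex.exp (2 * Real.pi * Complex.I / k)

/-- Cyclic eigen-idempotents / slot tensor powers (Atiyah 1966 §2). [folklore] -/
theorem zeta_isPrimitiveRoot {k : ℕ} (hk : k ≠ 0) : IsPrimitiveRoot (zeta k) k :=
  Complex.isPrimitiveRoot_exp k hk

/-- Cyclic eigen-idempotents / slot tensor powers (Atiyah 1966 §2). [folklore] -/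
theorem zeta_ne_zero (k : ℕ) : zeta k ≠ 0 := Complex.exp_ne_zero _

/-- Cyclic eigen-idempotents / slot tensor powers (Atiyah 1966 §2). [folklore] -/
theorem zeta_zpow_eq_one_iff {k : ℕ} (hk : k ≠ 0) (l : ℤ) : zeta k ^ l = 1 ↔ (k : ℤ) ∣ l :=
  (zeta_isPrimitiveRoot hk).zpow_eq_one_iff_dvd l

/-- Cyclic eigen-idempotents / slot tensor powers (Atiyah 1966 §2). [folklore] -/
theorem zeta_zpow_natCast_mul (k : ℕ) (l : ℤ) : zeta k ^ ((k : ℤ) * l) = 1 := by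
  rcases eq_or_ne k 0 with rfl | hk
  · simp
  · exact (zeta_zpow_eq_one_iff hk _).2 (dvd_mul_right _ _)

/-- **Orthogonality of characters of `ℤ/k`**: `∑_{i<k} ζ^{i l} = k` if `k ∣ l` and `0` otherwise. [folklore] -/
theorem sum_zeta_zpow {k : ℕ} (hk : k ≠ 0) (l : ℤ) :
    ∑ i ∈ range k, zeta k ^ ((i : ℤ) * l) = if (k : ℤ) ∣ l then (k : ℂ) else 0 := by
  have hx : ∀ i : ℕ, zeta k ^ ((i : ℤ) * l) = (zeta k ^ l) ^ i := fun i ↦ by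
    rw [mul_comm, zpow_mul, zpow_natCast]
  simp_rw [hx]
  split_ifs with h
  · rw [(zeta_zpow_eq_one_iff hk l).2 h]
    simp
  · have h1 : zeta k ^ l ≠ 1 := fun h' ↦ h ((zeta_zpow_eq_one_iff hk l).1 h')
    rw [geom_sum_eq h1, ← zpow_natCast, ← zpow_mul, mul_comm, zeta_zpow_natCast_mul, sub_self, zero_div]

/-- The coefficient `c_{i,j} = ζ^{-ij}/k` of the `j`-th eigen-idempotent. [folklore] -/
def ecoef (k : ℕ) (i : ℕ) (j : ℤ) : ℂ := zeta k ^ (-(i : ℤ) * j) / k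

/-- Cyclic eigen-idempotents / slot tensor powers (Atiyah 1966 §2). [folklore] -/
theorem ecoef_eq_mul_succ (k : ℕ) (i : ℕ) (j : ℤ) : ecoef k i j = zeta k ^ j * ecoef k (i + 1) j := by
  rw [ecoef, ecoef, mul_div_assoc', ← zpow_add₀ (zeta_ne_zero k)]
  congr 2
  push_cast
  ring

/-- Cyclic eigen-idempotents / slot tensor powers (Atiyah 1966 §2). [folklore] -/
theorem ecoef_self (k : ℕ) (j : ℤ) : ecoef k k j = ecoef k 0 j := by
  rw [ecoef, ecoef, neg_mul, zpow_neg, zeta_zpow_natCast_mul]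
  simp

/-- Cyclic eigen-idempotents / slot tensor powers (Atiyah 1966 §2). [folklore] -/
theorem ecoef_zero_left (k : ℕ) (j : ℤ) : ecoef k 0 j = 1 / k := by
  simp [ecoef]

/-- `∑_{j<k} c_{i,j} = [i = 0]` for `i < k`. [folklore] -/
theorem sum_ecoef {k : ℕ} (hk : k ≠ 0) {i : ℕ} (hi : i < k) :
    ∑ j ∈ range k, ecoef k i j = if i = 0 then 1 else 0 := by
  have h : ∑ j ∈ range k, ecoef k i j = (∑ j ∈ range k, zeta k ^ ((j : ℤ) * (-(i : ℤ)))) / k := by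
    rw [Finset.sum_div]
    refine Finset.sum_congr rfl fun j _ ↦ ?_
    rw [ecoef]; congr 2; ring
  rw [h, sum_zeta_zpow hk]
  have hk' : (k : ℂ) ≠ 0 := Nat.cast_ne_zero.2 hk
  by_cases hi0 : i = 0
  · subst hi0; simp [hk']
  · rw [if_neg, if_neg hi0, zero_div]
    rw [dvd_neg]
    intro hd
    have := Int.le_of_dvd (by exact_mod_cast Nat.pos_of_ne_zero hi0) hd
    omega

/-- `∑_{i<k} c_{i,j} ζ^{i c} = [k ∣ c - j]`. [folklore] -/
theorem sum_ecoef_mul_zpow {k : ℕ} (hk : k ≠ 0) (j c : ℤ) :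
    ∑ i ∈ range k, ecoef k i j * zeta k ^ ((i : ℤ) * c) = if (k : ℤ) ∣ c - j then 1 else 0 := by
  have h : ∑ i ∈ range k, ecoef k i j * zeta k ^ ((i : ℤ) * c) = (∑ i ∈ range k, zeta k ^ ((i : ℤ) * (c - j))) / k := by
    rw [Finset.sum_div]
    refine Finset.sum_congr rfl fun i _ ↦ ?_
    rw [ecoef, div_mul_eq_mul_div, ← zpow_add₀ (zeta_ne_zero k)]
    congr 2; ring
  rw [h, sum_zeta_zpow hk]
  have hk' : (k : ℂ) ≠ 0 := Nat.cast_ne_zero.2 hk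
  split_ifs <;> simp [hk']

end CharSum

/-! ### 2. Eigen-idempotents of an element of finite order in a `ℂ`-algebra -/

section Eig

variable {A : Type*} [Ring A] [Algebra ℂ A] {k : ℕ}

/-- The `j`-th **eigen-idempotent** `E_j(T) = (1/k) ∑_{i<k} ζ^{-ij} T^i` of an element `T` with
`T^k = 1` (projection onto the `ζ^j`-eigenspace of `T`). [cite: Atiyah1966PowerOperations, §2 (2.7)] -/
def eig (k : ℕ) (T : A) (j : ℤ) : A := ∑ i ∈ range k, ecoef k i j • T ^ i

omit [Algebra ℂ A] in
/-- Cyclic eigen-idempotents / slot tensor powers (Atiyah 1966 §2). [folklore] -/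
theorem pow_mod_of_pow_eq_one {T : A} (hT : T ^ k = 1) (n : ℕ) : T ^ (n % k) = T ^ n := by
  conv_rhs => rw [← Nat.div_add_mod n k, pow_add, pow_mul, hT, one_pow, one_mul]

/-- `T E_j(T) = ζ^j E_j(T)`. [folklore] -/
theorem mul_eig {T : A} (hT : T ^ k = 1) (j : ℤ) : T * eig k T j = (zeta k ^ j) • eig k T j := by
  unfold eig
  rw [Finset.mul_sum, Finset.smul_sum]
  have h1 : ∀ i ∈ range k, T * (ecoef k i j • T ^ i) = zeta k ^ j • (ecoef k (i + 1) j • T ^ (i + 1)) := by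
    intro i _
    rw [mul_smul_comm, ← pow_succ', smul_smul, ← ecoef_eq_mul_succ]
  rw [Finset.sum_congr rfl h1, ← Finset.smul_sum, ← Finset.smul_sum]
  congr 1
  have e1 := Finset.sum_range_succ' (fun i ↦ ecoef k i j • T ^ i) k
  have e2 := Finset.sum_range_succ (fun i ↦ ecoef k i j • T ^ i) k
  have hf : ecoef k k j • T ^ k = ecoef k 0 j • T ^ 0 := by rw [hT, ecoef_self, pow_zero]
  have h3 := e1.symm.trans e2
  rw [hf] at h3
  exact add_right_cancel h3

/-- `T^i E_j(T) = ζ^{ij} E_j(T)`. [folklore] -/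
theorem pow_mul_eig {T : A} (hT : T ^ k = 1) (j : ℤ) (i : ℕ) : T ^ i * eig k T j = (zeta k ^ ((i : ℤ) * j)) • eig k T j := by
  induction i with
  | zero => simp
  | succ i ih =>
    rw [pow_succ, mul_assoc, mul_eig hT, mul_smul_comm, ih, smul_smul, ← zpow_add₀ (zeta_ne_zero k)]
    congr 2; push_cast; ring

/-- **Eigen-lemma**: if `T X = ζ^c X` then `E_j(T) X = X` for `j ≡ c (mod k)` and `0` otherwise. [folklore] -/
theorem eig_mul_of_mul_eq_smul (hk : k ≠ 0) {T X : A} (c : ℤ) (hX : T * X = (zeta k ^ c) • X) (j : ℤ) :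
    eig k T j * X = if (k : ℤ) ∣ c - j then X else 0 := by
  have hpow : ∀ i : ℕ, T ^ i * X = (zeta k ^ ((i : ℤ) * c)) • X := by
    intro i
    induction i with
    | zero => simp
    | succ i ih =>
      rw [pow_succ, mul_assoc, hX, mul_smul_comm, ih, smul_smul, ← zpow_add₀ (zeta_ne_zero k)]
      congr 2; push_cast; ring
  unfold eig
  rw [Finset.sum_mul]
  simp_rw [smul_mul_assoc, hpow, smul_smul]
  rw [← Finset.sum_smul, sum_ecoef_mul_zpow hk]
  split_ifs <;> simp

/-- `E_j E_{j'} = [j ≡ j'] E_{j'}`. [folklore] -/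
theorem eig_mul_eig (hk : k ≠ 0) {T : A} (hT : T ^ k = 1) (j j' : ℤ) :
    eig k T j * eig k T j' = if (k : ℤ) ∣ j' - j then eig k T j' else 0 :=
  eig_mul_of_mul_eq_smul hk j' (mul_eig hT j') j

/-- Cyclic eigen-idempotents / slot tensor powers (Atiyah 1966 §2). [folklore] -/
theorem isIdempotentElem_eig (hk : k ≠ 0) {T : A} (hT : T ^ k = 1) (j : ℤ) : IsIdempotentElem (eig k T j) := by
  change eig k T j * eig k T j = eig k T j
  rw [eig_mul_eig hk hT, sub_self, if_pos (dvd_zero _)]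

/-- Cyclic eigen-idempotents / slot tensor powers (Atiyah 1966 §2). [folklore] -/
theorem eig_mul_eig_of_not_dvd (hk : k ≠ 0) {T : A} (hT : T ^ k = 1) {j j' : ℤ} (h : ¬ (k : ℤ) ∣ j' - j) :
    eig k T j * eig k T j' = 0 := by
  rw [eig_mul_eig hk hT, if_neg h]

/-- `∑_{j<k} E_j(T) = 1`. [folklore] -/
theorem sum_eig (hk : k ≠ 0) (T : A) : ∑ j ∈ range k, eig k T j = 1 := by
  unfold eig
  rw [Finset.sum_comm]
  have h : ∀ i ∈ range k, ∑ j ∈ range k, ecoef k i (j : ℕ) • T ^ i = if i = 0 then T ^ i else 0 := by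
    intro i hi
    rw [← Finset.sum_smul]
    have hs : ∑ j ∈ range k, ecoef k i ((j : ℕ) : ℤ) = ∑ j ∈ range k, ecoef k i j := rfl
    rw [sum_ecoef hk (Finset.mem_range.1 hi)]
    split_ifs <;> simp
  rw [Finset.sum_congr rfl h, Finset.sum_ite_eq']
  simp [hk]

/-- `E_j` commutes with everything commuting with `T`. [folklore] -/
theorem eig_comm {T X : A} (h : T * X = X * T) (j : ℤ) : eig k T j * X = X * eig k T j := by
  unfold eig
  rw [Finset.sum_mul, Finset.mul_sum]
  refine Finset.sum_congr rfl fun i _ ↦ ?_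
  rw [smul_mul_assoc, mul_smul_comm, (Commute.pow_left h i).eq]

/-- Cyclic eigen-idempotents / slot tensor powers (Atiyah 1966 §2). [folklore] -/
theorem eig_comm_self (T : A) (j : ℤ) : eig k T j * T = T * eig k T j := eig_comm rfl j

/-- **Conjugation**: `u E_j(T) v = E_j(u T v)` for inverse units `u`, `v`. [folklore] -/
theorem conj_eig {T u v : A} (hvu : v * u = 1) (huv : u * v = 1) (j : ℤ) : u * eig k T j * v = eig k (u * T * v) j := by
  have hpow : ∀ i : ℕ, u * T ^ i * v = (u * T * v) ^ i := by
    intro i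
    induction i with
    | zero => rw [pow_zero, pow_zero, mul_one, huv]
    | succ i ih =>
      rw [pow_succ, pow_succ, ← ih]
      simp only [mul_assoc]
      rw [← mul_assoc v u, hvu, one_mul]
  unfold eig
  rw [Finset.mul_sum, Finset.sum_mul]
  refine Finset.sum_congr rfl fun i _ ↦ ?_
  rw [mul_smul_comm, smul_mul_assoc, hpow]

omit [Algebra ℂ A] in
/-- The conjugate `u T v` again satisfies `(u T v)^k = 1`. [folklore] -/
theorem conj_pow_eq_one {T u v : A} (hvu : v * u = 1) (huv : u * v = 1) (hT : T ^ k = 1) : (u * T * v) ^ k = 1 := by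
  have hpow : ∀ i : ℕ, u * T ^ i * v = (u * T * v) ^ i := by
    intro i
    induction i with
    | zero => rw [pow_zero, pow_zero, mul_one, huv]
    | succ i ih =>
      rw [pow_succ, pow_succ, ← ih]
      simp only [mul_assoc]
      rw [← mul_assoc v u, hvu, one_mul]
  rw [← hpow, hT, mul_one, huv]

/-- **Scaling**: `E_j(ζ^a T) = E_{j-a}(T)`. [folklore] -/
theorem eig_smul (T : A) (a j : ℤ) : eig k ((zeta k ^ a) • T) j = eig k T (j - a) := by
  unfold eig
  refine Finset.sum_congr rfl fun i _ ↦ ?_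
  rw [smul_pow, smul_smul]
  congr 1
  rw [ecoef, ecoef, ← zpow_natCast, ← zpow_mul, div_mul_eq_mul_div, ← zpow_add₀ (zeta_ne_zero k)]
  congr 2; ring

/-- `E_j` depends on `j` only modulo `k`. [folklore] -/
theorem eig_add_natCast_mul (T : A) (j m : ℤ) : eig k T (j + k * m) = eig k T j := by
  unfold eig
  refine Finset.sum_congr rfl fun i _ ↦ ?_
  congr 1
  rw [ecoef, ecoef]
  congr 1
  rw [show -(i : ℤ) * (j + k * m) = -(i : ℤ) * j + (k : ℤ) * (-(i : ℤ) * m) by ring, zpow_add₀ (zeta_ne_zero k),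
    zeta_zpow_natCast_mul, mul_one]

/-- **Inversion**: `E_j(T^{k-1}) = E_{-j}(T)` (eigen-idempotents of `T⁻¹ = T^{k-1}`). [folklore] -/
theorem eig_pow_pred (hk : k ≠ 0) {T : A} (hT : T ^ k = 1) (j : ℤ) : eig k (T ^ (k - 1)) j = eig k T (-j) := by
  set T' := T ^ (k - 1) with hT'
  have hT'k : T' ^ k = 1 := by rw [hT', ← pow_mul, mul_comm, pow_mul, hT, one_pow]
  have hTT' : T * T' = 1 := by
    rw [hT', ← pow_succ']
    obtain ⟨m, rfl⟩ := Nat.exists_eq_succ_of_ne_zero hk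
    rw [Nat.succ_sub_one, hT]
  set X := eig k T (-j) with hX
  set E' := eig k T' j with hE'
  -- `T' X = ζ^j X`
  have h1 : T' * X = (zeta k ^ j) • X := by
    rw [hT', hX, pow_mul_eig hT, show ((k - 1 : ℕ) : ℤ) * -j = j + k * (-j) by
      push_cast [Nat.one_le_iff_ne_zero.2 hk]; ring,
      zpow_add₀ (zeta_ne_zero k), zeta_zpow_natCast_mul, mul_one]
  -- `T E' = ζ^{-j} E'`
  have h2 : T * E' = (zeta k ^ (-j)) • E' := by
    have h := mul_eig hT'k j
    have h' : E' = (zeta k ^ j) • (T * E') := by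
      rw [← mul_smul_comm, ← h, ← mul_assoc, hTT', one_mul]
    rw [h', smul_smul, zpow_neg, inv_mul_cancel₀ (zpow_ne_zero _ (zeta_ne_zero k)), one_smul, ← h']
  have ha : E' * X = X := by
    have := eig_mul_of_mul_eq_smul hk j h1 j
    rwa [sub_self, if_pos (dvd_zero _)] at this
  have hb : X * E' = E' := by
    have := eig_mul_of_mul_eq_smul hk (-j) h2 (-j)
    rwa [sub_self, if_pos (dvd_zero _)] at this
  have hc : E' * X = X * E' := by
    refine eig_comm ?_ j
    have hTX : T * X = X * T := (eig_comm_self T (-j)).symm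
    exact (Commute.pow_left hTX (k - 1)).eq
  rw [← hb, ← hc, ha]

end Eig





open Matrix Finset

universe u

variable {R : Type u} [CommRing R]
variable {ι κ μ : Type*}
variable {N : ℕ}

/-! ### 3. Slot tensor powers -/

/-- The **slotwise tensor product** `a₀ ⊗ a₁ ⊗ ⋯ ⊗ a_{N-1}` of a family of rectangular matrices,
indexed by slot functions `Fin N → ι`: entry `∏_m a_m (i m) (j m)`. [folklore] -/
def tpowF (a : Fin N → Matrix ι κ R) : Matrix (Fin N → ι) (Fin N → κ) R :=
  Matrix.of fun i j ↦ ∏ m, a m (i m) (j m)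

/-- The `N`-th **tensor power** `a^{⊗N}` of a rectangular matrix. [cite: Atiyah1966PowerOperations, §2] -/
abbrev tpow (N : ℕ) (a : Matrix ι κ R) : Matrix (Fin N → ι) (Fin N → κ) R := tpowF fun _ : Fin N ↦ a

/-- Cyclic eigen-idempotents / slot tensor powers (Atiyah 1966 §2). [folklore] -/
@[simp] theorem tpowF_apply (a : Fin N → Matrix ι κ R) (i : Fin N → ι) (j : Fin N → κ) :
    tpowF a i j = ∏ m, a m (i m) (j m) := rfl

/-- Cyclic eigen-idempotents / slot tensor powers (Atiyah 1966 §2). [folklore] -/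
theorem tpow_apply (a : Matrix ι κ R) (i : Fin N → ι) (j : Fin N → κ) :
    tpow N a i j = ∏ m, a (i m) (j m) := rfl

/-- `(a ⊗ ⋯) (b ⊗ ⋯) = (a b) ⊗ ⋯` slotwise. [folklore] -/
theorem tpowF_mul [Fintype κ] (a : Fin N → Matrix ι κ R) (b : Fin N → Matrix κ μ R) :
    tpowF (fun m ↦ a m * b m) = tpowF a * tpowF b := by
  ext i j
  simp only [tpowF_apply, Matrix.mul_apply]
  rw [Finset.prod_univ_sum (fun _ ↦ (Finset.univ : Finset κ)) (fun m l ↦ a m (i m) l * b m l (j m))]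
  simp only [Fintype.piFinset_univ, Finset.prod_mul_distrib]

/-- Cyclic eigen-idempotents / slot tensor powers (Atiyah 1966 §2). [folklore] -/
theorem tpow_mul [Fintype κ] (a : Matrix ι κ R) (b : Matrix κ μ R) : tpow N (a * b) = tpow N a * tpow N b :=
  tpowF_mul _ _

/-- `1 ⊗ ⋯ ⊗ 1 = 1`. [folklore] -/
theorem tpowF_one [DecidableEq ι] : tpowF (fun _ : Fin N ↦ (1 : Matrix ι ι R)) = 1 := by
  ext i j
  simp only [tpowF_apply, Matrix.one_apply]
  rw [Fintype.prod_boole]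
  simp [funext_iff]

/-- Cyclic eigen-idempotents / slot tensor powers (Atiyah 1966 §2). [folklore] -/
theorem tpow_one [DecidableEq ι] : tpow N (1 : Matrix ι ι R) = 1 := tpowF_one

/-- Cyclic eigen-idempotents / slot tensor powers (Atiyah 1966 §2). [folklore] -/
theorem isIdempotentElem_tpowF [Fintype ι] {a : Fin N → Matrix ι ι R} (ha : ∀ m, IsIdempotentElem (a m)) :
    IsIdempotentElem (tpowF a) := by
  change tpowF a * tpowF a = tpowF a
  rw [← tpowF_mul]
  congr 1
  funext m
  exact (ha m).eq

/-- Cyclic eigen-idempotents / slot tensor powers (Atiyah 1966 §2). [folklore] -/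
theorem isIdempotentElem_tpow [Fintype ι] {a : Matrix ι ι R} (ha : IsIdempotentElem a) : IsIdempotentElem (tpow N a) :=
  isIdempotentElem_tpowF fun _ ↦ ha

/-- Cyclic eigen-idempotents / slot tensor powers (Atiyah 1966 §2). [folklore] -/
theorem tpowF_zero {a : Fin N → Matrix ι κ R} (m : Fin N) (hm : a m = 0) : tpowF a = 0 := by
  ext i j
  simp only [tpowF_apply, Matrix.zero_apply]
  exact Finset.prod_eq_zero (Finset.mem_univ m) (by rw [hm]; rfl)

/-- Ring homomorphisms act slotwise. [folklore] -/
theorem tpowF_map {S : Type*} [CommRing S] (f : R →+* S) (a : Fin N → Matrix ι κ R) :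
    (tpowF a).map f = tpowF fun m ↦ (a m).map f := by
  ext i j
  simp [tpowF_apply, map_prod]

/-! ### Slot permutations -/

/-- A permutation of the slots acts on slot functions by precomposition. [folklore] -/
def slotEquiv (ι : Type*) (σ : Equiv.Perm (Fin N)) : (Fin N → ι) ≃ (Fin N → ι) where
  toFun i := i ∘ σ
  invFun i := i ∘ σ.symm
  left_inv i := by ext m; simp
  right_inv i := by ext m; simp

/-- Cyclic eigen-idempotents / slot tensor powers (Atiyah 1966 §2). [folklore] -/
@[simp] theorem slotEquiv_apply (σ : Equiv.Perm (Fin N)) (i : Fin N → ι) : slotEquiv ι σ i = i ∘ σ := rfl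

/-- Cyclic eigen-idempotents / slot tensor powers (Atiyah 1966 §2). [folklore] -/
@[simp] theorem slotEquiv_symm (σ : Equiv.Perm (Fin N)) : (slotEquiv ι σ).symm = slotEquiv ι σ⁻¹ := rfl

/-- Cyclic eigen-idempotents / slot tensor powers (Atiyah 1966 §2). [folklore] -/
theorem slotEquiv_one : slotEquiv ι (1 : Equiv.Perm (Fin N)) = Equiv.refl _ := by
  ext i m; rfl

/-- Cyclic eigen-idempotents / slot tensor powers (Atiyah 1966 §2). [folklore] -/
theorem slotEquiv_mul (σ τ : Equiv.Perm (Fin N)) : slotEquiv ι (σ * τ) = (slotEquiv ι σ).trans (slotEquiv ι τ) := by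
  ext i m; rfl

/-- Re-indexing all slots by `σ` turns `⊗_m a_m` into `⊗_m a_{σ⁻¹ m}`. [folklore] -/
theorem tpowF_submatrix_slotEquiv (a : Fin N → Matrix ι κ R) (σ : Equiv.Perm (Fin N)) :
    (tpowF a).submatrix (slotEquiv ι σ) (slotEquiv κ σ) = tpowF fun m ↦ a (σ.symm m) := by
  ext i j
  simp only [submatrix_apply, tpowF_apply, slotEquiv_apply, Function.comp_apply]
  rw [← Equiv.prod_comp σ (fun m ↦ a (σ.symm m) (i m) (j m))]
  simp

/-- Tensor powers are invariant under slot permutations. [cite: Atiyah1966PowerOperations, §2] -/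
theorem tpow_submatrix_slotEquiv (a : Matrix ι κ R) (σ : Equiv.Perm (Fin N)) :
    (tpow N a).submatrix (slotEquiv ι σ) (slotEquiv κ σ) = tpow N a :=
  tpowF_submatrix_slotEquiv _ σ

/-- The **permutation matrix** of a slot permutation. [folklore] -/
def pm (R : Type u) [CommRing R] (ι : Type*) [Fintype ι] [DecidableEq ι] (σ : Equiv.Perm (Fin N)) : Matrix (Fin N → ι) (Fin N → ι) R :=
  (1 : Matrix (Fin N → ι) (Fin N → ι) R).submatrix (slotEquiv ι σ) id

/-- Cyclic eigen-idempotents / slot tensor powers (Atiyah 1966 §2). [folklore] -/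
theorem pm_apply [Fintype ι] [DecidableEq ι] (σ : Equiv.Perm (Fin N)) (i j : Fin N → ι) : pm R ι σ i j = if i ∘ σ = j then 1 else 0 := rfl

/-- Cyclic eigen-idempotents / slot tensor powers (Atiyah 1966 §2). [folklore] -/
theorem pm_mul [Fintype ι] [DecidableEq ι] (σ : Equiv.Perm (Fin N)) (M : Matrix (Fin N → ι) κ R) : pm R ι σ * M = M.submatrix (slotEquiv ι σ) id := by
  ext i j
  simp only [Matrix.mul_apply, pm_apply, ite_mul, one_mul, zero_mul, Finset.sum_ite_eq, Finset.mem_univ, if_true,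
    submatrix_apply, slotEquiv_apply, id]

/-- Cyclic eigen-idempotents / slot tensor powers (Atiyah 1966 §2). [folklore] -/
theorem mul_pm [Fintype ι] [DecidableEq ι] (σ : Equiv.Perm (Fin N)) (M : Matrix κ (Fin N → ι) R) : M * pm R ι σ = M.submatrix id (slotEquiv ι σ⁻¹) := by
  ext i j
  simp only [Matrix.mul_apply, pm_apply, mul_ite, mul_one, mul_zero, submatrix_apply, slotEquiv_apply, id]
  rw [Finset.sum_eq_single (j ∘ ⇑σ⁻¹)]
  · simp [Function.comp_assoc]
  · intro l _ hl
    rw [if_neg]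
    rintro rfl
    exact hl (by ext m; simp)
  · simp

/-- Cyclic eigen-idempotents / slot tensor powers (Atiyah 1966 §2). [folklore] -/
theorem pm_one [Fintype ι] [DecidableEq ι] : pm R ι (1 : Equiv.Perm (Fin N)) = 1 := by
  rw [pm, slotEquiv_one]; rfl

/-- Cyclic eigen-idempotents / slot tensor powers (Atiyah 1966 §2). [folklore] -/
theorem pm_mul_pm [Fintype ι] [DecidableEq ι] (σ τ : Equiv.Perm (Fin N)) : pm R ι σ * pm R ι τ = pm R ι (σ * τ) := by
  rw [pm_mul, pm, pm, submatrix_submatrix, slotEquiv_mul]; rfl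

/-- Cyclic eigen-idempotents / slot tensor powers (Atiyah 1966 §2). [folklore] -/
theorem pm_inv_mul [Fintype ι] [DecidableEq ι] (σ : Equiv.Perm (Fin N)) : pm R ι σ⁻¹ * pm R ι σ = 1 := by rw [pm_mul_pm, inv_mul_cancel, pm_one]

/-- Cyclic eigen-idempotents / slot tensor powers (Atiyah 1966 §2). [folklore] -/
theorem pm_mul_inv [Fintype ι] [DecidableEq ι] (σ : Equiv.Perm (Fin N)) : pm R ι σ * pm R ι σ⁻¹ = 1 := by rw [pm_mul_pm, mul_inv_cancel, pm_one]

/-- Cyclic eigen-idempotents / slot tensor powers (Atiyah 1966 §2). [folklore] -/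
theorem pm_pow [Fintype ι] [DecidableEq ι] (σ : Equiv.Perm (Fin N)) (n : ℕ) : pm R ι σ ^ n = pm R ι (σ ^ n) := by
  induction n with
  | zero => rw [pow_zero, pow_zero, pm_one]
  | succ n ih => rw [pow_succ, ih, pm_mul_pm, pow_succ]

/-- **Conjugating by a slot permutation permutes the tensor factors**:
`P_σ (⊗_m a_m) P_σ⁻¹ = ⊗_m a_{σ⁻¹ m}`. [cite: Atiyah1966PowerOperations, §2] -/
theorem pm_mul_tpowF_mul_pm [Fintype ι] [DecidableEq ι] [Fintype κ] [DecidableEq κ] (σ : Equiv.Perm (Fin N)) (a : Fin N → Matrix ι κ R) :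
    pm R ι σ * tpowF a * pm R κ σ⁻¹ = tpowF fun m ↦ a (σ.symm m) := by
  rw [pm_mul, mul_pm, inv_inv, submatrix_submatrix, ← tpowF_submatrix_slotEquiv]; rfl

/-- Cyclic eigen-idempotents / slot tensor powers (Atiyah 1966 §2). [folklore] -/
theorem pm_mul_tpowF [Fintype ι] [DecidableEq ι] [Fintype κ] [DecidableEq κ] (σ : Equiv.Perm (Fin N)) (a : Fin N → Matrix ι κ R) :
    pm R ι σ * tpowF a = (tpowF fun m ↦ a (σ.symm m)) * pm R κ σ := by
  rw [← pm_mul_tpowF_mul_pm σ a, Matrix.mul_assoc, pm_inv_mul, Matrix.mul_one]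

/-- Slot permutation matrices commute with tensor powers (of rectangular matrices, with the
permutation matrices of the two sizes). [cite: Atiyah1966PowerOperations, §2] -/
theorem pm_mul_tpow [Fintype ι] [DecidableEq ι] [Fintype κ] [DecidableEq κ] (σ : Equiv.Perm (Fin N)) (a : Matrix ι κ R) : pm R ι σ * tpow N a = tpow N a * pm R κ σ :=
  pm_mul_tpowF σ _

/-- Cyclic eigen-idempotents / slot tensor powers (Atiyah 1966 §2). [folklore] -/
theorem pm_map [Fintype ι] [DecidableEq ι] {S : Type*} [CommRing S] (f : R →+* S) (σ : Equiv.Perm (Fin N)) : (pm R ι σ).map f = pm S ι σ := by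
  ext i j
  simp only [map_apply, pm_apply]
  split_ifs <;> simp

/-! ### Line elements: matrices all of whose `2 × 2` minors vanish -/

/-- A square matrix is a **line element** if all its `2 × 2` minors vanish (rank `≤ 1`; for an
idempotent over `C(X, ℂ)`: a line bundle). [folklore] -/
def IsLine (a : Matrix ι ι R) : Prop := ∀ r r' c c', a r c * a r' c' = a r' c * a r c'

/-- For a line element, a transposition of two slots acts trivially on `a^{⊗N}` from the left. [folklore] -/
theorem IsLine.tpow_comp_swap {a : Matrix ι ι R} (ha : IsLine a) (x y : Fin N) (i j : Fin N → ι) :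
    tpow N a (i ∘ Equiv.swap x y) j = tpow N a i j := by
  rcases eq_or_ne x y with rfl | hxy
  · simp
  simp only [tpow_apply, Function.comp_apply]
  rw [← Finset.mul_prod_erase _ _ (Finset.mem_univ x), ← Finset.mul_prod_erase _ _ (Finset.mem_univ x)]
  rw [← Finset.mul_prod_erase _ _ (Finset.mem_erase.2 ⟨hxy.symm, Finset.mem_univ y⟩),
    ← Finset.mul_prod_erase _ _ (Finset.mem_erase.2 ⟨hxy.symm, Finset.mem_univ y⟩)]
  have hrest : ∀ m ∈ (Finset.univ.erase x).erase y, a (i (Equiv.swap x y m)) (j m) = a (i m) (j m) := by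
    intro m hm
    simp only [Finset.mem_erase] at hm
    rw [Equiv.swap_apply_of_ne_of_ne hm.2.1 hm.1]
  rw [Finset.prod_congr rfl hrest, Equiv.swap_apply_left, Equiv.swap_apply_right, ← mul_assoc, ← mul_assoc,
    ha (i y) (i x) (j x) (j y)]

/-- For a line element, every slot permutation acts trivially on `a^{⊗N}` from the left:
`P_σ a^{⊗N} = a^{⊗N}`. [cite: Atiyah1966PowerOperations, §2 (2.7)] -/
theorem IsLine.pm_mul_tpow [Fintype ι] [DecidableEq ι] {a : Matrix ι ι R} (ha : IsLine a) (σ : Equiv.Perm (Fin N)) :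
    pm R ι σ * tpow N a = tpow N a := by
  induction σ using Equiv.Perm.swap_induction_on with
  | one => rw [pm_one, Matrix.one_mul]
  | swap_mul σ x y hxy ih =>
    rw [← pm_mul_pm, Matrix.mul_assoc, ih, pm_mul]
    ext i j
    simp only [submatrix_apply, slotEquiv_apply, id]
    exact ha.tpow_comp_swap x y i j

/-- Cyclic eigen-idempotents / slot tensor powers (Atiyah 1966 §2). [folklore] -/
theorem IsLine.map {S : Type*} [CommRing S] (f : R →+* S) {a : Matrix ι ι R} (ha : IsLine a) : IsLine (a.map f) := by
  intro r r' c c'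
  simp only [map_apply, ← map_mul, ha r r' c c']

/-- A `1 × 1` matrix is a line element. [folklore] -/
theorem isLine_of_subsingleton [Subsingleton ι] (a : Matrix ι ι R) : IsLine a := by
  intro r r' c c'
  rw [Subsingleton.elim r' r]

/-- `x y` with `x` a column and `y` a row is a line element. [folklore] -/
theorem isLine_col_mul_row {o : Type*} [Fintype o] [Subsingleton o] (x : Matrix ι o R) (y : Matrix o ι R) : IsLine (x * y) := by
  intro r r' c c'
  rcases isEmpty_or_nonempty o with ho | ⟨⟨z⟩⟩
  · simp [Matrix.mul_apply]
  · have : (Finset.univ : Finset o) = {z} := Finset.eq_singleton_iff_unique_mem.2 ⟨Finset.mem_univ _, fun w _ ↦ Subsingleton.elim w z⟩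
    simp only [Matrix.mul_apply, this, Finset.sum_singleton]
    ring

end Literature.RingTheory.KTheory

end
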